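import Literature.NumberTheory.Automorphic.InfUnitaryOneParameterGroupDeriv
import Literature.NumberTheory.Automorphic.GKModulesKActionAlongCurves
import Mathlib.Analysis.InnerProductSpace.Calculus
import HarnessLib

/-!
# The one-parameter groups `U` of an infinitesimally unitary module along curves: `d/ds U (τ s) (emb (ρK (k s) u))`

Topic `NumberTheory/Automorphic`; namespace `Literature.NumberTheory.Automorphic.IsPosDefHerm`; sequel of ★ `InfUnitaryOneParameterGroupDeriv` ((U4)) and ★
`GKModulesKActionAlongCurves` («KD»).  Cell `hodgecm-mathlib`, F0∕P3, ROAD-GLOB to the letter A6 #92 `HasUnitaryGlobalizationOfInfUnitary` at `U(2,1)`: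
the product∕chain rule consumed by Φ2 (the torus translation law), where the matrix coefficient `⟪U_{H₀}(τ(s)) ϖK(k₂(s)) ι u, ϖK(k₁(s))⁻¹ ι w⟫` of the
KAK section is differentiated.  Theorems only; no definition, no named fact, no instance, no notation, no `sorry`.

THE MATHEMATICS ([HarishChandra1953, §9]; [KnappVogan1995, §I.4 (1.64)–(1.65)]).  With the data of ★ `InfUnitaryOneParameterGroup` (`hB`, `ρ`, line bounds
for `X`, `0 < K`), a `(𝔤, K)`-module structure `hV : IsGKModule G ρK ρ` on a regular `G` over a finite-dimensional coefficient algebra, a real function `τ`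
with `HasDerivAt τ τ′ s₀` and a curve `k : ℝ → K` whose matrix has derivative `k(s₀) · Y` (`Y ∈ 𝔨`) at `s₀`:
**`d/ds|_{s₀} U K X (τ s) (emb (ρK (k s) u)) = τ′ • U K X (τ s₀) (emb (ρ X (ρK (k s₀) u))) + U K X (τ s₀) (emb (ρK (k s₀) (ρ Y u)))`**
(`hasDerivAt_U_comp_emb_curve`): expand `ρK (k s) u` in a basis of the finite-dimensional `K`-span of `u` (coordinates differentiable by ★
`hasDerivAt_coeff_curve`), differentiate each `s ↦ U K X (τ s) (emb bᵢ)` by (U4) ★ `hasDerivAt_U_emb` and the chain rule, and recombine by linearity.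
Also the scalar∕inner-product form against a second `K`-curve acting on `w` (`hasDerivAt_inner_U_comp_emb_curve`).

HONEST LABEL: helper brick; closes no registered stub.  HC_CM is proved only modulo the 2 remaining named inputs (hLiu418, h413) until rung 0 closes.

## Mathlib ∕ tree search
Mathlib: `HasDerivAt.scomp`, `HasDerivAt.smul`, `HasDerivAt.fun_sum`, `HasDerivAt.inner` (`Mathlib.Analysis.InnerProductSpace.Calculus`).  Tree: ★ `hasDerivAt_U_emb`
(U4), ★ `IsGKModule.hasDerivAt_coeff_curve`, ★ `IsGKModule.coordFn`∕`sum_coordFn_smul`.  Dedup: `rg "hasDerivAt_U_comp_emb_curve"` — no hits.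

## References
* Harish-Chandra, *Representations of a semisimple Lie group on a Banach space. I*, Trans. AMS 75 (1953), §9 [HarishChandra1953].
* A. W. Knapp, D. A. Vogan, *Cohomological Induction and Unitary Representations* (1995), §I.4 (1.64)–(1.65) [KnappVogan1995].
-/

set_option autoImplicit false

noncomputable section

-- Mathlib idiom (as in ★ `GKModules`): the commutator bracket on `Module.End ℂ V`, to MENTION `ρ : 𝔤 →ₗ⁅ℝ⁆ End V`.
attribute [local instance 100] LieRing.ofAssociativeRing

open Filter Topology Finset Matrix
open scoped Nat InnerProductSpace Matrix.Norms.Operator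

namespace Literature.NumberTheory.Automorphic

namespace IsPosDefHerm

universe u

variable {A : Type*} [NormedCommRing A] [NormedAlgebra ℝ A] [NormedAlgebra ℚ A] [CompleteSpace A]
  [StarRing A] [StarModule ℝ A] [ContinuousStar A] [FiniteDimensional ℝ A] {N : Type*} [Fintype N] [DecidableEq N]
  {G : RealMatrixGroup A N}
  {V : Type u} [AddCommGroup V] [Module ℂ V] {B : V →ₗ⋆[ℂ] V →ₗ[ℂ] ℂ} (hB : IsPosDefHerm B)
  {ρK : Representation ℂ G.maximalCompact V} {ρ : G.lie →ₗ⁅ℝ⁆ Module.End ℂ V}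
include hB

/-- **`d/ds U K X (τ s) (emb (ρK (k s) u))`** — chain rule in the time `τ s` ((U4)) and the `K`-derivative along the curve `k` («KD»), combined on
the finite-dimensional `K`-span of `u`. [cite: HarishChandra1953, §9] [cite: KnappVogan1995, §I.4 (1.64)–(1.65)] -/
theorem hasDerivAt_U_comp_emb_curve (hreg : ∀ X : Matrix N N A, (∀ t : ℝ, expGL (t • X) ∈ G.carrier) → X ∈ G.lie)
    (hV : IsGKModule G ρK ρ) {K : ℝ} (hK : 0 < K) {X : G.lie} (hX : ∀ x y, B (ρ X x) y = -B x (ρ X y))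
    (hb : ∀ v : V, ∃ C : ℝ, ∀ n, ‖hB.emb (((ρ X : V →ₗ[ℂ] V) ^ n) v)‖ ≤ C * n ! * (K * ‖(X : Matrix N N A)‖) ^ n)
    {τ : ℝ → ℝ} {τ' s₀ : ℝ} (hτ : HasDerivAt τ τ' s₀) {k : ℝ → G.maximalCompact} {Y : G.compactLie}
    (hk : HasDerivAt (fun s => (((k s : G.maximalCompact) : GL N A) : Matrix N N A))
      ((((k s₀ : G.maximalCompact) : GL N A) : Matrix N N A) * (Y : Matrix N N A)) s₀) (u : V) :
    HasDerivAt (fun s => hB.U ρ K X (τ s) (hB.emb (ρK (k s) u)))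
      (τ' • hB.U ρ K X (τ s₀) (hB.emb (ρ X (ρK (k s₀) u))) +
        hB.U ρ K X (τ s₀) (hB.emb (ρK (k s₀) (ρ (LieSubalgebra.inclusion G.compactLie_le_lie Y) u)))) s₀ := by
  -- the `K`-span of `u`, a basis, coordinates
  set F : Submodule ℂ V := Submodule.span ℂ (Set.range fun k : G.maximalCompact => ρK k u) with hFdef
  haveI : FiniteDimensional ℂ F := hV.kFinite u
  have hF : ∀ (k : G.maximalCompact), ∀ w ∈ F, ρK k w ∈ F := by
    intro k' w hw
    have hmap : F.map (ρK k' : V →ₗ[ℂ] V) ≤ F := by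
      rw [hFdef, Submodule.map_span]
      refine Submodule.span_mono ?_
      rintro _ ⟨_, ⟨k'', rfl⟩, rfl⟩
      exact ⟨k' * k'', by simp [map_mul]⟩
    exact hmap ⟨w, hw, rfl⟩
  have hu : u ∈ F := by
    have h1 : ρK 1 u ∈ F := Submodule.subset_span ⟨1, rfl⟩
    rwa [map_one, Module.End.one_apply] at h1
  let b := Module.finBasis ℂ F
  -- coordinates `c i s` and their derivatives
  let c : Fin (Module.finrank ℂ F) → ℝ → ℂ := fun i s => IsGKModule.coordFn b i (ρK (k s) u)
  have hc : ∀ i, HasDerivAt (c i) (IsGKModule.coordFn b i (ρK (k s₀) (ρ (LieSubalgebra.inclusion G.compactLie_le_lie Y) u))) s₀ :=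
    fun i => IsGKModule.hasDerivAt_coeff_curve hreg hV hk u (IsGKModule.coordFn b i)
  -- the vectors `w i s := U (τ s) (emb (b i))` and their derivatives
  have hw : ∀ i, HasDerivAt (fun s => hB.U ρ K X (τ s) (hB.emb (b i : V)))
      (τ' • hB.U ρ K X (τ s₀) (hB.emb (ρ X (b i : V)))) s₀ := fun i =>
    (hB.hasDerivAt_U_emb hK hX hb (b i : V) (τ s₀)).scomp s₀ hτ
  -- the expansion
  have hexp : ∀ s, hB.U ρ K X (τ s) (hB.emb (ρK (k s) u)) = ∑ i, c i s • hB.U ρ K X (τ s) (hB.emb (b i : V)) := by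
    intro s
    conv_lhs => rw [← IsGKModule.sum_coordFn_smul b (hF _ _ hu)]
    simp only [map_sum, map_smul, c]
  have hfun : (fun s => hB.U ρ K X (τ s) (hB.emb (ρK (k s) u))) = fun s => ∑ i, c i s • hB.U ρ K X (τ s) (hB.emb (b i : V)) :=
    funext hexp
  rw [hfun]
  have hsum := HasDerivAt.fun_sum fun i (_ : i ∈ Finset.univ) => (hc i).smul (hw i)
  refine hsum.congr_deriv ?_
  -- identify the derivative
  have hmemY : ρK (k s₀) (ρ (LieSubalgebra.inclusion G.compactLie_le_lie Y) u) ∈ F :=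
    hF _ _ (IsGKModule.apply_mem_of_K_stable_of_hasWeakDeriv hV.hasWeakDeriv Y hF hu)
  rw [Finset.sum_add_distrib]
  congr 1
  · -- `Σ c i s₀ • τ' • U (emb (ρ X bᵢ)) = τ' • U (emb (ρ X (ρK (k s₀) u)))`
    have h1 : ∑ i, c i s₀ • (τ' • hB.U ρ K X (τ s₀) (hB.emb (ρ X (b i : V)))) =
        τ' • hB.U ρ K X (τ s₀) (hB.emb (ρ X (∑ i, c i s₀ • (b i : V)))) := by
      simp only [map_sum, map_smul, Finset.smul_sum]
      refine Finset.sum_congr rfl fun i _ => ?_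
      rw [smul_comm]
    rw [h1, IsGKModule.sum_coordFn_smul b (hF (k s₀) u hu)]
  · -- `Σ c i' • U (emb bᵢ) = U (emb (ρK (k s₀) (ρ Y u)))`
    have h2 : ∑ i, IsGKModule.coordFn b i (ρK (k s₀) (ρ (LieSubalgebra.inclusion G.compactLie_le_lie Y) u)) • hB.U ρ K X (τ s₀) (hB.emb (b i : V)) =
        hB.U ρ K X (τ s₀) (hB.emb (∑ i, IsGKModule.coordFn b i (ρK (k s₀) (ρ (LieSubalgebra.inclusion G.compactLie_le_lie Y) u)) • (b i : V))) := by
      simp only [map_sum, map_smul]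
    rw [h2, IsGKModule.sum_coordFn_smul b hmemY]

/-- **The matrix coefficient along two `K`-curves**: for a second curve `k₁ : ℝ → K` (matrix derivative `k₁(s₀) · Y₁`) and `w ∈ V`,
`d/ds ⟪U K X (τ s) (emb (ρK (k s) u)), emb (ρK (k₁ s) w)⟫` is given by the product rule (Mathlib `HasDerivAt.inner`) with the two derivatives
of `hasDerivAt_U_comp_emb_curve` and ★ `hasDerivAt_map_curve`. [cite: HarishChandra1953, §9] [cite: KnappVogan1995, §I.4 (1.64)–(1.65)] -/
theorem hasDerivAt_inner_U_comp_emb_curve (hreg : ∀ X : Matrix N N A, (∀ t : ℝ, expGL (t • X) ∈ G.carrier) → X ∈ G.lie)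
    (hV : IsGKModule G ρK ρ) {K : ℝ} (hK : 0 < K) {X : G.lie} (hX : ∀ x y, B (ρ X x) y = -B x (ρ X y))
    (hb : ∀ v : V, ∃ C : ℝ, ∀ n, ‖hB.emb (((ρ X : V →ₗ[ℂ] V) ^ n) v)‖ ≤ C * n ! * (K * ‖(X : Matrix N N A)‖) ^ n)
    {τ : ℝ → ℝ} {τ' s₀ : ℝ} (hτ : HasDerivAt τ τ' s₀) {k k₁ : ℝ → G.maximalCompact} {Y Y₁ : G.compactLie}
    (hk : HasDerivAt (fun s => (((k s : G.maximalCompact) : GL N A) : Matrix N N A))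
      ((((k s₀ : G.maximalCompact) : GL N A) : Matrix N N A) * (Y : Matrix N N A)) s₀)
    (hk₁ : HasDerivAt (fun s => (((k₁ s : G.maximalCompact) : GL N A) : Matrix N N A))
      ((((k₁ s₀ : G.maximalCompact) : GL N A) : Matrix N N A) * (Y₁ : Matrix N N A)) s₀) (u w : V) :
    HasDerivAt (fun s => ⟪hB.U ρ K X (τ s) (hB.emb (ρK (k s) u)), hB.emb (ρK (k₁ s) w)⟫_ℂ)
      (⟪hB.U ρ K X (τ s₀) (hB.emb (ρK (k s₀) u)), hB.emb (ρK (k₁ s₀) (ρ (LieSubalgebra.inclusion G.compactLie_le_lie Y₁) w))⟫_ℂ +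
        ⟪τ' • hB.U ρ K X (τ s₀) (hB.emb (ρ X (ρK (k s₀) u))) +
            hB.U ρ K X (τ s₀) (hB.emb (ρK (k s₀) (ρ (LieSubalgebra.inclusion G.compactLie_le_lie Y) u))),
          hB.emb (ρK (k₁ s₀) w)⟫_ℂ) s₀ :=
  (hB.hasDerivAt_U_comp_emb_curve hreg hV hK hX hb hτ hk u).inner ℂ (IsGKModule.hasDerivAt_map_curve hreg hV hk₁ hB.emb w)

end IsPosDefHerm

end Literature.NumberTheory.Automorphic

end
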